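import Mathlib
import HarnessLib
import Summits.NavierStokesRegularity.NavierStokesRegularity.Theorems.PoloidalWindowDoorLrcModEntireShearedKinematics

/-!
# Route `PoloidalWindowDoor`, item `LrcModEntire` (stmt-NavierStokesRegularity-20428), cell (Q4-sonic), slot `stub_Q4sonicLineNeg`, case I —
# S4c WIRING, STEP (i): joint ↔ slice conversions for `g = ∂_eU₂` and the horizontal Laplacian of `g` in sheared coordinates

Cell ns-regularity-ideate, helper seat ns-k2-port-2 g8 under the LEAD of item 20428 (ns-poloidal-K2-p3 g17, memo `T2B-g17.md` v4 §7 S4; custody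
`RECORD-OF-CUSTODY-port-2-g8.md` §8 recipe (i)); `--supports stmt-NavierStokesRegularity-20428 --as helper`.  Class-free.

`W : ℝ × ℝ³ → ℝ³` smooth on `T × ℝ³` (`T` open), `gST W e (q) = DW(q)[(0,e)]₂` (`…ShearedKinematics`), `g_t := (y ↦ D(W(t,·))(y)[e]₂)` the slice quantity
(= `fun y => fderiv ℝ (fun y' => W (t,y')) y e 2`, the currency of `…HorizDerivTransportLaw` / `…HorizDerivLaplacianSplit` with `u = W(t,·)`):
* `gST_slice` — `gST W e (t,x) = g_t(x)`;
* `fderiv_gST_time` — `D(gST)(t,x)[(1,0)] = ∂ₛ|ₛ₌ₜ g_s(x)` (the `∂ₜg` of the transport law);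
* `fderiv_gST_space` — `D(gST)(t,x)[(0,w)] = Dg_t(x)[w]`;
* `fderiv_fderiv_gST_space` — `D²(gST)(t,x)[(0,a)][(0,b)] = ∂_a∂_b g_t(x)` (nested);
* ★ `pd_sum_gST_comp_shearMap` — on the tube of the moving shear `Φ` (`…ShearedCoordinates`), `e` a horizontal unit vector, at `Φp = (t,x)`:
  **`∂_m²(g∘Φ)(p) + ∂_s²(g∘Φ)(p) = (∂₀∂₀ + ∂₁∂₁) g_t (x)`** — the left side of `…HorizDerivLaplacianSplit.laplacian_horizDeriv_two`, so that
  `Δg_t(x) = (1 − μ)·(g_mm + g_ss)(p)` on the (TH) slab.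
WHAT THIS IS NOT: not a claim about Navier–Stokes regularity; no stub is closed here; items 20428 / 19708 / 27893 OPEN.
-/

noncomputable section

set_option linter.dupNamespace false
set_option linter.style.longLine false

namespace Summit.NavierStokesRegularity.NavierStokesRegularity.Theorems.PoloidalWindowDoorLrcModEntireShearedSecondOrder

open Set Function Filter Topology
open scoped ContDiff
open Summit.NavierStokesRegularity.NavierStokesRegularity.Theorems.PoloidalWindowDoorLrcModEntireSheetSystemUniqueness
open Summit.NavierStokesRegularity.NavierStokesRegularity.Theorems.PoloidalWindowDoorLrcModEntireSheetFlattenTools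
open Summit.NavierStokesRegularity.NavierStokesRegularity.Theorems.PoloidalWindowDoorLrcModEntireShearedCoordinates
open Summit.NavierStokesRegularity.NavierStokesRegularity.Theorems.PoloidalWindowDoorLrcModEntireShearedKinematics

variable {W : ℝ × E3 → E3} {e : E3} {T : Set ℝ}

/-- `gST` restricted to a slice is the slice quantity `y ↦ D(W(t,·))(y)[e]₂`. -/
theorem gST_slice (hT : IsOpen T) (hW : ContDiffOn ℝ ∞ W (T ×ˢ (univ : Set E3))) {t : ℝ} (ht : t ∈ T) (x : E3) :
    gST W e (t, x) = fderiv ℝ (fun y : E3 => W (t, y)) x e 2 := by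
  rw [gST, ← fderiv_slice_eq ((regular_at hT hW (q := (t, x)) ht).2.1) e]

/-- `gST` is differentiable (indeed `C^∞`) at points of `T × ℝ³`. -/
theorem gST_regular (hT : IsOpen T) (hW : ContDiffOn ℝ ∞ W (T ×ˢ (univ : Set E3))) {q : ℝ × E3} (hq : q.1 ∈ T) :
    ContDiffAt ℝ ∞ (gST W e) q ∧ DifferentiableAt ℝ (gST W e) q ∧ DifferentiableAt ℝ (fderiv ℝ (gST W e)) q := by
  have hg : ContDiffAt ℝ ∞ (gST W e) q :=
    (contDiffOn_gST_PST_QST (e := e) hT hW).1.contDiffAt ((hT.prod isOpen_univ).mem_nhds ⟨hq, mem_univ _⟩)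
  exact ⟨hg, hg.differentiableAt (by simp), (hg.fderiv_right (m := 1) (by norm_cast)).differentiableAt (by norm_num)⟩

/-- Slice derivative = joint derivative in a spatial direction, for any target space: `D(G(t,·))(x)[v] = DG(t,x)[(0,v)]`. -/
theorem fderiv_slice_eq' {F : Type*} [NormedAddCommGroup F] [NormedSpace ℝ F] {G : ℝ × E3 → F} {t : ℝ} {x : E3}
    (hG : DifferentiableAt ℝ G (t, x)) (v : E3) :
    fderiv ℝ (fun y => G (t, y)) x v = fderiv ℝ G (t, x) ((0 : ℝ), v) := by
  have h := hG.hasFDerivAt.comp x (hasFDerivAt_prodMk_right t x)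
  rw [show (G ∘ Prod.mk t) = fun y => G (t, y) from rfl] at h
  rw [h.fderiv]
  simp

/-- **The `∂ₜg` of the transport law:** `D(gST)(t,x)[(1,0)] = d/ds|ₛ₌ₜ D(W(s,·))(x)[e]₂`. -/
theorem fderiv_gST_time (hT : IsOpen T) (hW : ContDiffOn ℝ ∞ W (T ×ˢ (univ : Set E3))) {t : ℝ} (ht : t ∈ T) (x : E3) :
    fderiv ℝ (gST W e) (t, x) ((1 : ℝ), (0 : E3)) = deriv (fun s : ℝ => fderiv ℝ (fun y : E3 => W (s, y)) x e 2) t := by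
  obtain ⟨-, hGd, -⟩ := gST_regular (e := e) hT hW (q := (t, x)) ht
  have hline : HasDerivAt (fun s : ℝ => ((s, x) : ℝ × E3)) ((1 : ℝ), (0 : E3)) t :=
    (hasDerivAt_id t).prodMk (hasDerivAt_const t x)
  have h := hGd.hasFDerivAt.comp_hasDerivAt t hline
  have hev : (fun s : ℝ => gST W e (s, x)) =ᶠ[𝓝 t] fun s => fderiv ℝ (fun y : E3 => W (s, y)) x e 2 := by
    filter_upwards [hT.mem_nhds ht] with s hs using gST_slice hT hW hs x
  rw [← hev.deriv_eq]
  exact h.deriv.symm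

/-- `D(gST)(t,x)[(0,w)] = Dg_t(x)[w]`. -/
theorem fderiv_gST_space (hT : IsOpen T) (hW : ContDiffOn ℝ ∞ W (T ×ˢ (univ : Set E3))) {t : ℝ} (ht : t ∈ T) (x w : E3) :
    fderiv ℝ (gST W e) (t, x) ((0 : ℝ), w) = fderiv ℝ (fun y : E3 => fderiv ℝ (fun y' : E3 => W (t, y')) y e 2) x w := by
  obtain ⟨-, hGd, -⟩ := gST_regular (e := e) hT hW (q := (t, x)) ht
  have hfun : (fun y : E3 => gST W e (t, y)) = fun y => fderiv ℝ (fun y' : E3 => W (t, y')) y e 2 := by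
    funext y; exact gST_slice hT hW ht y
  rw [← hfun]
  exact (fderiv_slice_eq' hGd w).symm

/-- `D²(gST)(t,x)[(0,a)][(0,b)] = ∂_a∂_b g_t(x)` (nested slice second derivative). -/
theorem fderiv_fderiv_gST_space (hT : IsOpen T) (hW : ContDiffOn ℝ ∞ W (T ×ˢ (univ : Set E3))) {t : ℝ} (ht : t ∈ T) (x a b : E3) :
    fderiv ℝ (fderiv ℝ (gST W e)) (t, x) ((0 : ℝ), a) ((0 : ℝ), b) =
      fderiv ℝ (fun y : E3 => fderiv ℝ (fun y' : E3 => fderiv ℝ (fun y'' : E3 => W (t, y'')) y' e 2) y b) x a := by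
  obtain ⟨-, -, hDGd⟩ := gST_regular (e := e) hT hW (q := (t, x)) ht
  have h1 : fderiv ℝ (fderiv ℝ (gST W e)) (t, x) ((0 : ℝ), a) ((0 : ℝ), b) =
      fderiv ℝ (fun q' : ℝ × E3 => fderiv ℝ (gST W e) q' ((0 : ℝ), b)) (t, x) ((0 : ℝ), a) := by
    rw [fderiv_clm_apply hDGd (differentiableAt_const _)]; simp
  have hd : DifferentiableAt ℝ (fun q' : ℝ × E3 => fderiv ℝ (gST W e) q' ((0 : ℝ), b)) (t, x) := hDGd.clm_apply (differentiableAt_const _)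
  have h2 := fderiv_slice_eq' hd a
  have hfun : (fun y : E3 => fderiv ℝ (gST W e) (t, y) ((0 : ℝ), b)) = fun y => fderiv ℝ (fun y' : E3 => fderiv ℝ (fun y'' : E3 => W (t, y'')) y' e 2) y b := by
    funext y; exact fderiv_gST_space hT hW ht y b
  rw [h1, ← h2, hfun]

variable {O : Set Y3} {D : Set (ℝ × ℝ)} {d : ℝ × ℝ → ℝ}

/-- ★ **The horizontal Laplacian of `g` in sheared coordinates:** at a tube point `p` with `Φp = (t,x)` (`t = p.1.1`, `x = shearPt e d p`), for a horizontal unit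
vector `e`: `∂_m²(g∘Φ)(p) + ∂_s²(g∘Φ)(p) = ∂₀∂₀g_t(x) + ∂₁∂₁g_t(x)`. -/
theorem pd_sum_gST_comp_shearMap (hO : IsOpen O) (hT : IsOpen T) (hW : ContDiffOn ℝ ∞ W (T ×ˢ (univ : Set E3)))
    (he2 : e 2 = 0) (hunit : e 0 ^ 2 + e 1 ^ 2 = 1)
    (hOT : ∀ y ∈ O, y.1 ∈ T) (hD : IsOpen D) (hd : ContDiffOn ℝ ∞ d D) (hOD : ∀ y ∈ O, (y.1, y.2.2) ∈ D) {p : Y3 × ℝ} (hp : p ∈ tube O) :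
    pd dN (pd dN (gST W e ∘ shearMap e d)) p + pd (tg eS) (pd (tg eS) (gST W e ∘ shearMap e d)) p =
      fderiv ℝ (fun y : E3 => fderiv ℝ (fun y' : E3 => fderiv ℝ (fun y'' : E3 => W (p.1.1, y'')) y' e 2) y (EuclideanSpace.single 0 (1 : ℝ)))
          (shearPt e d p) (EuclideanSpace.single 0 (1 : ℝ)) +
        fderiv ℝ (fun y : E3 => fderiv ℝ (fun y' : E3 => fderiv ℝ (fun y'' : E3 => W (p.1.1, y'')) y' e 2) y (EuclideanSpace.single 1 (1 : ℝ)))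
          (shearPt e d p) (EuclideanSpace.single 1 (1 : ℝ)) := by
  have hgs := (contDiffOn_gST_PST_QST (e := e) hT hW).1
  rw [pd_dN_pd_dN_comp_shearMap hO hT hgs hOT hD hd hOD hp, pd_tgS_pd_tgS_comp_shearMap hO hT hgs hOT hD hd hOD hp]
  have ht : p.1.1 ∈ T := hOT p.1 hp
  have hq : shearMap e d p = (p.1.1, shearPt e d p) := rfl
  rw [hq]
  set B : E3 →L[ℝ] E3 →L[ℝ] ℝ :=
    (fderiv ℝ (fderiv ℝ (gST W e)) (p.1.1, shearPt e d p)).bilinearComp (ContinuousLinearMap.inr ℝ ℝ E3) (ContinuousLinearMap.inr ℝ ℝ E3) with hB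
  have hBab : ∀ a b : E3, B a b = fderiv ℝ (fderiv ℝ (gST W e)) (p.1.1, shearPt e d p) ((0 : ℝ), a) ((0 : ℝ), b) := fun a b => by
    simp [hB]
  have hfr := bilin_frame_trace B he2 hunit
  rw [hBab, hBab, hBab, hBab] at hfr
  rw [add_comm, hfr, fderiv_fderiv_gST_space hT hW ht, fderiv_fderiv_gST_space hT hW ht]

end Summit.NavierStokesRegularity.NavierStokesRegularity.Theorems.PoloidalWindowDoorLrcModEntireShearedSecondOrder
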